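import Literature.NumberTheory.Transcendental.ThetaSubgroupClassification
import Literature.NumberTheory.Transcendental.EllipticKronecker
import HarnessLib

/-!
# The lineality space of a `Θ`-closed subgroup of `Lie M_κ`: torus and vector directions split off

Topic: `Literature/NumberTheory/Transcendental`. A brick of the discharge of the named fact
`Literature.NumberTheory.Transcendental.philippon1986_std` (classification of the obstruction
subgroups of Philippon's zero estimate on `M_κ = 𝔾ₘ^β × P_κ`, general number of elliptic factors).
Let `H ⊆ V = Lie M_κ,ℂ = ℂ^β × ℂ^γ × ℂ^δ` be a closed additive subgroup for the `Θ`-topology of a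
theta model (`AnalyticGroupModel.IsClosedG`) and `𝔥 = 𝒯(H)` its lineality space
(`AnalyticGroupModel.linSpace`). The periodicity lemmas of `ThetaSubgroupHull.lean` (orbit
closures: Baker's generalised Vandermonde lemma, the Artin move on characters, the lattice move)
yield the algebraic structure of `𝔥`:

* `sEmb_sPart_mem_linSpace`, `yEmb_yPart_mem_linSpace` — a vector `(y, 0, s) ∈ 𝔥` with vanishing
  `E`-coordinates has `(0,0,s) ∈ 𝔥` and `(y,0,0) ∈ 𝔥`: the part of `𝔥` over `z' = 0` is the
  product `yDir 𝔥 × 0 × sDir 𝔥`;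
* `mem_yDir_iff_forall_int` — the torus directions `yDir 𝔥 = {θ : (θ,0,0) ∈ 𝔥}` form a RATIONAL
  subspace: `θ ∈ yDir 𝔥 ↔ ⟨q, θ⟩ = 0` for all integer `q` killing `yDir 𝔥` (Artin move);
* `kappaVec_mem_and_zEmb_mem` — if the `E`-projection `𝔷₀ = z'(𝔥)` is spanned by integer
  vectors (the saturation proved in the sequel from the Kronecker lemma and a dimension count),
  then the COMPATIBILITY `(0, 0, κ ζ) ∈ 𝔥` and the splitting `(0, ζ, 0) ∈ 𝔥` hold for all
  `ζ ∈ 𝔷₀` (two lattice moves at `ω₁σ`, `ω₂σ` for a lift `σ` of an integer vector and the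
  Legendre relation `ω₁η₂ - ω₂η₁ ≠ 0` give `κv, s(σ) ∈ sDir`; the torus part of the lift is moved
  into `yDir` by the Artin move on the subgroup of the `ω_i y(σ)`, which translate `H` into itself:
  a character of `ℤ^β` trivial on `ω₁y` and `ω₂y` kills `y` since `ω₂/ω₁ ∉ ℝ`).

With the saturation of `𝔷₀` these facts make `𝔥` the Lie algebra of an explicit connected
algebraic subgroup datum (sequel). Everything is PROVED; the only definitions are the blocks
`yDir`, `sDir`, `zProj`, `zEmb`, `kappaVec(ₗ)`, `intVec`, `yRelQ`.

## References

* Yu. V. Nesterenko, P. Philippon (eds.), *Introduction to Algebraic Independence Theory*,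
  LNM 1752, Springer 2001, Ch. 11 (D. Roy), Thm. 4.1. [NesterenkoPhilippon2001]
* D. Bertrand, P. Philippon, *Sous-groupes algébriques de groupes algébriques commutatifs*,
  Illinois J. Math. 32 (1988), 263–280. [folklore]
-/

noncomputable section

open Complex MvPolynomial Module
open scoped PeriodPair

namespace Literature.NumberTheory.Transcendental

namespace GaGmE

namespace Std

variable {β γ δ : Type} [Fintype β] [Fintype γ] [Fintype δ] [DecidableEq γ]
variable (L : PeriodPair) (κM : δ → γ → Kbar)

/-! ### Blocks of a subspace -/

/-- The torus directions of `𝔥`: `{θ : (θ, 0, 0) ∈ 𝔥}`. [folklore] -/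
def yDir (𝔥 : Submodule ℂ (β ⊕ (γ ⊕ δ) → ℂ)) : Submodule ℂ (β → ℂ) := 𝔥.comap (yEmb (γ := γ) (δ := δ))

/-- The vector directions of `𝔥`: `{σ : (0, 0, σ) ∈ 𝔥}`. [folklore] -/
def sDir (𝔥 : Submodule ℂ (β ⊕ (γ ⊕ δ) → ℂ)) : Submodule ℂ (δ → ℂ) := 𝔥.comap (sEmb (β := β) (γ := γ))

/-- The `E`-projection `w ↦ z'(w)`. [folklore] -/
def zProj : (β ⊕ (γ ⊕ δ) → ℂ) →ₗ[ℂ] (γ → ℂ) where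
  toFun w := zPart w
  map_add' _ _ := rfl
  map_smul' _ _ := rfl

omit [Fintype β] [Fintype γ] [Fintype δ] [DecidableEq γ] in
/-- Unfolding `zProj`. [folklore] -/
@[simp] theorem zProj_apply (w : β ⊕ (γ ⊕ δ) → ℂ) (b : γ) : zProj w b = w (iz b) := rfl

omit [Fintype β] [Fintype γ] [Fintype δ] [DecidableEq γ] in
/-- Membership in `yDir`. [folklore] -/
theorem mem_yDir_iff {𝔥 : Submodule ℂ (β ⊕ (γ ⊕ δ) → ℂ)} {θ : β → ℂ} : θ ∈ yDir 𝔥 ↔ coords θ 0 0 ∈ 𝔥 := Iff.rfl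

omit [Fintype β] [Fintype γ] [Fintype δ] [DecidableEq γ] in
/-- Membership in `sDir`. [folklore] -/
theorem mem_sDir_iff {𝔥 : Submodule ℂ (β ⊕ (γ ⊕ δ) → ℂ)} {σ : δ → ℂ} : σ ∈ sDir 𝔥 ↔ coords 0 0 σ ∈ 𝔥 := Iff.rfl

/-- The vector `κ ζ = (∑_b κ_{eb} ζ_b)_e` (the Lie image of the abelian part in the vector part). [folklore] -/
def kappaVec (ζ : γ → ℂ) : δ → ℂ := fun e => ∑ b, (κM e b : ℂ) * ζ b

/-- An integer vector of `ℂ^γ`. [folklore] -/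
def intVec (v : γ → ℤ) : γ → ℂ := fun b => (v b : ℂ)

/-! ### Directions of the lineality space from vanishing of forms -/

section Model

variable {N : ℕ} (M : AnalyticGroupModel (β ⊕ (γ ⊕ δ) → ℂ) N) (e : Option β × ThetaIdx γ δ ≃ Fin (N + 1))
variable (hΘ : ∀ J w, M.Θ (e J) w = theta L κM J w)
include hΘ

/-- **Test for the lineality space of a closed subgroup**: `x ∈ 𝒯(H)` as soon as every form
vanishing on `H` vanishes at `w + t x` for all `w ∈ H`, `t ∈ ℂ`. [folklore] -/
theorem mem_linSpace_of_forall_thetaEval {H : AddSubgroup (β ⊕ (γ ⊕ δ) → ℂ)}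
    (hH : M.IsClosedG (H : Set (β ⊕ (γ ⊕ δ) → ℂ))) {x : β ⊕ (γ ⊕ δ) → ℂ}
    (hx : ∀ (D : ℕ) (P : MvPolynomial (Option β × ThetaIdx γ δ) ℂ), P.IsHomogeneous D →
      (∀ v ∈ H, thetaEval L κM P v = 0) → ∀ w ∈ H, ∀ t : ℂ, thetaEval L κM P (w + t • x) = 0) :
    x ∈ AnalyticGroupModel.linSpace (H : Set (β ⊕ (γ ⊕ δ) → ℂ)) := by
  intro w hw t
  exact mem_of_isClosedG L κM M e hΘ hH fun D P hP hvan => hx D P hP hvan w hw t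

/-- **The vector part splits off**: for `r = (y, 0, s) ∈ 𝒯(H)`, `(0, 0, s) ∈ 𝒯(H)` — periodicity
lemma along `ℕ r` with `θ = 0`. [folklore] -/
theorem sEmb_sPart_mem_linSpace {H : AddSubgroup (β ⊕ (γ ⊕ δ) → ℂ)}
    (hH : M.IsClosedG (H : Set (β ⊕ (γ ⊕ δ) → ℂ))) {r : β ⊕ (γ ⊕ δ) → ℂ}
    (hr : r ∈ AnalyticGroupModel.linSpace (H : Set (β ⊕ (γ ⊕ δ) → ℂ))) (hrz : ∀ b, r (iz b) = 0) :
    coords (0 : β → ℂ) (0 : γ → ℂ) (sPart r) ∈ AnalyticGroupModel.linSpace (H : Set (β ⊕ (γ ⊕ δ) → ℂ)) := by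
  refine mem_linSpace_of_forall_thetaEval L κM M e hΘ hH fun D P _ hvan w hw t => ?_
  have h := thetaEval_eq_zero_of_forall_natMul L κM P (w := w) hrz
    (fun n => hvan _ (hr w hw n)) (θ := 0) (fun q _ => by simp) t
  have hv : t • coords (0 : β → ℂ) (0 : γ → ℂ) (sPart r) = coords (0 : β → ℂ) (0 : γ → ℂ) fun e' => t * r (is e') := by
    rw [← coords_smul, smul_zero, smul_zero]
    rfl
  rw [hv]
  exact h

omit [Fintype β] [Fintype γ] [Fintype δ] [DecidableEq γ] hΘ in
/-- A vector with vanishing `E`-coordinates is the sum of its torus and vector parts. [folklore] -/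
theorem eq_coords_add_of_z_eq_zero {r : β ⊕ (γ ⊕ δ) → ℂ} (hrz : ∀ b, r (iz b) = 0) :
    r = coords (yPart r) (0 : γ → ℂ) (0 : δ → ℂ) + coords (0 : β → ℂ) (0 : γ → ℂ) (sPart r) := by
  funext k; rcases k with j | b | e'
  · change r (iy j) = (coords (yPart r) (0 : γ → ℂ) (0 : δ → ℂ) + coords (0 : β → ℂ) (0 : γ → ℂ) (sPart r)) (iy j)
    simp [yPart]
  · change r (iz b) = (coords (yPart r) (0 : γ → ℂ) (0 : δ → ℂ) + coords (0 : β → ℂ) (0 : γ → ℂ) (sPart r)) (iz b)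
    simp [hrz b]
  · change r (is e') = (coords (yPart r) (0 : γ → ℂ) (0 : δ → ℂ) + coords (0 : β → ℂ) (0 : γ → ℂ) (sPart r)) (is e')
    simp [sPart]

/-- **The torus part splits off**: for `r = (y, 0, s) ∈ 𝒯(H)`, `(y, 0, 0) ∈ 𝒯(H)`. [folklore] -/
theorem yEmb_yPart_mem_linSpace {H : AddSubgroup (β ⊕ (γ ⊕ δ) → ℂ)}
    (hH : M.IsClosedG (H : Set (β ⊕ (γ ⊕ δ) → ℂ))) {r : β ⊕ (γ ⊕ δ) → ℂ}
    (hr : r ∈ AnalyticGroupModel.linSpace (H : Set (β ⊕ (γ ⊕ δ) → ℂ))) (hrz : ∀ b, r (iz b) = 0) :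
    coords (yPart r) (0 : γ → ℂ) (0 : δ → ℂ) ∈ AnalyticGroupModel.linSpace (H : Set (β ⊕ (γ ⊕ δ) → ℂ)) := by
  have hs := sEmb_sPart_mem_linSpace L κM M e hΘ hH hr hrz
  have : coords (yPart r) (0 : γ → ℂ) (0 : δ → ℂ) = r - coords (0 : β → ℂ) (0 : γ → ℂ) (sPart r) := by
    rw [eq_sub_iff_add_eq]
    exact (eq_coords_add_of_z_eq_zero hrz).symm
  rw [this]
  exact Submodule.sub_mem _ hr hs

/-- The part of `𝒯(H)` over `z' = 0` is the product `yDir × 0 × sDir`. [folklore] -/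
theorem mem_linSpace_iff_of_z_eq_zero {H : AddSubgroup (β ⊕ (γ ⊕ δ) → ℂ)}
    (hH : M.IsClosedG (H : Set (β ⊕ (γ ⊕ δ) → ℂ))) {r : β ⊕ (γ ⊕ δ) → ℂ} (hrz : ∀ b, r (iz b) = 0) :
    r ∈ AnalyticGroupModel.linSpace (H : Set (β ⊕ (γ ⊕ δ) → ℂ)) ↔
      yPart r ∈ yDir (AnalyticGroupModel.linSpace (H : Set (β ⊕ (γ ⊕ δ) → ℂ))) ∧
        sPart r ∈ sDir (AnalyticGroupModel.linSpace (H : Set (β ⊕ (γ ⊕ δ) → ℂ))) := by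
  constructor
  · intro hr
    exact ⟨yEmb_yPart_mem_linSpace L κM M e hΘ hH hr hrz, sEmb_sPart_mem_linSpace L κM M e hΘ hH hr hrz⟩
  · rintro ⟨hy, hs⟩
    rw [eq_coords_add_of_z_eq_zero hrz]
    exact Submodule.add_mem _ hy hs

/-! ### The torus directions form a rational subspace (Artin move) -/

/-- **Artin move for the lineality space**: every `θ` orthogonal to the integer characters trivial
on `yDir 𝒯(H)` is a torus direction of `𝒯(H)`. [folklore] -/
theorem mem_yDir_of_forall_int {H : AddSubgroup (β ⊕ (γ ⊕ δ) → ℂ)}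
    (hH : M.IsClosedG (H : Set (β ⊕ (γ ⊕ δ) → ℂ))) {θ : β → ℂ}
    (hθ : ∀ q : β → ℤ, (∀ g ∈ yDir (AnalyticGroupModel.linSpace (H : Set (β ⊕ (γ ⊕ δ) → ℂ))),
      ∑ j, (q j : ℂ) * g j = 0) → ∑ j, (q j : ℂ) * θ j = 0) :
    θ ∈ yDir (AnalyticGroupModel.linSpace (H : Set (β ⊕ (γ ⊕ δ) → ℂ))) := by
  set 𝔥 := AnalyticGroupModel.linSpace (H : Set (β ⊕ (γ ⊕ δ) → ℂ)) with h𝔥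
  rw [mem_yDir_iff]
  refine mem_linSpace_of_forall_thetaEval L κM M e hΘ hH fun D P _ hvan w hw t => ?_
  -- the Artin move on the subgroup `yDir 𝔥`
  have hmem : t • θ ∈ charPerp (β := β) (yDir 𝔥).toAddSubgroup := by
    refine Submodule.smul_mem _ t ((mem_charPerp_iff).mpr fun q hq => hθ q fun g hg => ?_)
    -- `e^{⟨q, g'⟩} = 1` on the subspace `yDir 𝔥` forces `⟨q, g⟩ = 0`
    have h2pi : ∀ c : ℂ, cexp (c * ∑ j, (q j : ℂ) * g j) = 1 := by
      intro c
      have := hq (c • g) (Submodule.smul_mem _ c hg)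
      rw [← this]
      congr 1
      simp only [Pi.smul_apply, smul_eq_mul, Finset.mul_sum]
      exact Finset.sum_congr rfl fun j _ => by ring
    exact eq_zero_of_forall_exp_mul_eq_one h2pi
  have h := thetaEval_eq_zero_of_forall_mem_addSubgroup L κM P (w := w) (yDir 𝔥).toAddSubgroup
    (fun g hg => hvan _ (by simpa using (mem_yDir_iff.mp hg) w hw 1)) hmem
  have hv : t • coords θ (0 : γ → ℂ) (0 : δ → ℂ) = coords (t • θ) (0 : γ → ℂ) (0 : δ → ℂ) := by
    rw [← coords_smul, smul_zero, smul_zero]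
  rw [hv]
  exact h

/-- The rational relations of the torus directions. [folklore] -/
def yRelQ (Y : Submodule ℂ (β → ℂ)) : Submodule ℚ (β → ℚ) where
  carrier := {q | ∀ g ∈ Y, ∑ j, (q j : ℂ) * g j = 0}
  zero_mem' := fun g _ => by simp
  add_mem' := by
    intro q q' hq hq' g hg
    simp only [Pi.add_apply, Rat.cast_add, add_mul, Finset.sum_add_distrib, hq g hg, hq' g hg, add_zero]
  smul_mem' := by
    intro c q hq g hg
    simp only [Pi.smul_apply, smul_eq_mul, Rat.cast_mul, mul_assoc, ← Finset.mul_sum, hq g hg, mul_zero]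

omit [Fintype γ] [Fintype δ] [DecidableEq γ] hΘ in
/-- Membership in `yRelQ`. [folklore] -/
theorem mem_yRelQ_iff {Y : Submodule ℂ (β → ℂ)} {q : β → ℚ} : q ∈ yRelQ Y ↔ ∀ g ∈ Y, ∑ j, (q j : ℂ) * g j = 0 :=
  Iff.rfl

/-- **The torus directions of `𝒯(H)` are cut out by their rational relations.** [folklore] -/
theorem mem_yDir_iff_forall_yRelQ {H : AddSubgroup (β ⊕ (γ ⊕ δ) → ℂ)}
    (hH : M.IsClosedG (H : Set (β ⊕ (γ ⊕ δ) → ℂ))) (θ : β → ℂ) :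
    θ ∈ yDir (AnalyticGroupModel.linSpace (H : Set (β ⊕ (γ ⊕ δ) → ℂ))) ↔
      ∀ q ∈ yRelQ (yDir (AnalyticGroupModel.linSpace (H : Set (β ⊕ (γ ⊕ δ) → ℂ)))), ∑ j, (q j : ℂ) * θ j = 0 := by
  constructor
  · intro hθ q hq; exact hq θ hθ
  · intro h
    refine mem_yDir_of_forall_int L κM M e hΘ hH fun q hq => ?_
    have := h (fun j => (q j : ℚ)) (fun g hg => by simpa using hq g hg)
    simpa using this

/-! ### The lattice move: compatibility and splitting of the `E`-directions -/

/-- **The lattice move for the lineality space**: for `t ∈ 𝒯(H)` with lattice `E`-coordinates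
`z'(t) = mω₁ + nω₂`, the corrected vector `(0, 0, s(t) - κ η(z'(t))) ∈ 𝒯(H)`. [folklore] -/
theorem sEmb_sub_mem_linSpace {H : AddSubgroup (β ⊕ (γ ⊕ δ) → ℂ)}
    (hH : M.IsClosedG (H : Set (β ⊕ (γ ⊕ δ) → ℂ))) {t : β ⊕ (γ ⊕ δ) → ℂ}
    (ht : t ∈ AnalyticGroupModel.linSpace (H : Set (β ⊕ (γ ⊕ δ) → ℂ))) (m n : γ → ℤ)
    (htz : ∀ b, t (iz b) = (m b : ℂ) * L.ω₁ + (n b : ℂ) * L.ω₂) :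
    coords (0 : β → ℂ) (0 : γ → ℂ)
        (fun e' => t (is e') - ∑ b, (κM e' b : ℂ) * ((m b : ℂ) * L.η₁ + (n b : ℂ) * L.η₂)) ∈
      AnalyticGroupModel.linSpace (H : Set (β ⊕ (γ ⊕ δ) → ℂ)) := by
  refine mem_linSpace_of_forall_thetaEval L κM M e hΘ hH fun D P hP hvan w hw τ => ?_
  have h := thetaEval_eq_zero_of_forall_natMul_lattice L κM hP (X := (H : Set _)) hvan m n htz
    (fun k => ht w hw k) (θ := 0) (fun q _ => by simp) τ
  have hv : τ • coords (0 : β → ℂ) (0 : γ → ℂ)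
      (fun e' => t (is e') - ∑ b, (κM e' b : ℂ) * ((m b : ℂ) * L.η₁ + (n b : ℂ) * L.η₂)) =
      coords (0 : β → ℂ) (0 : γ → ℂ)
      (fun e' => τ * (t (is e') - ∑ b, (κM e' b : ℂ) * ((m b : ℂ) * L.η₁ + (n b : ℂ) * L.η₂))) := by
    rw [← coords_smul, smul_zero, smul_zero]
    rfl
  rw [hv]
  exact h

omit [Fintype β] [Fintype γ] [Fintype δ] [DecidableEq γ] hΘ in
/-- **`ω₂/ω₁ ∉ ℚ`**: if `a ω₁` and `a ω₂` are both integer multiples of `2πi` then `a = 0`. [folklore] -/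
theorem eq_zero_of_mul_omega_mem_two_pi_I {a : ℂ} (h1 : ∃ k : ℤ, a * L.ω₁ = k * (2 * Real.pi * I))
    (h2 : ∃ k : ℤ, a * L.ω₂ = k * (2 * Real.pi * I)) : a = 0 := by
  obtain ⟨k₁, hk₁⟩ := h1
  obtain ⟨k₂, hk₂⟩ := h2
  by_contra ha
  have h2pi : (2 * Real.pi * I : ℂ) ≠ 0 := by simp [Real.pi_ne_zero, I_ne_zero]
  have hω₁ : L.ω₁ ≠ 0 := fun h => by
    have := L.indep; rw [LinearIndependent.pair_iff] at this
    have := this 1 0 (by simp [h]); simp at this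
  have hk₁0 : (k₁ : ℂ) ≠ 0 := by
    intro h0; rw [h0, zero_mul] at hk₁; exact (mul_ne_zero ha hω₁) hk₁
  -- `ω₂ / ω₁ = k₂ / k₁` is real: contradiction with the independence of `ω₁, ω₂` over `ℝ`
  have hrel : (k₂ : ℂ) * L.ω₁ - (k₁ : ℂ) * L.ω₂ = 0 := by
    have e1 : (k₂ : ℂ) * (a * L.ω₁) = (k₁ : ℂ) * (a * L.ω₂) := by rw [hk₁, hk₂]; ring
    have : a * ((k₂ : ℂ) * L.ω₁ - (k₁ : ℂ) * L.ω₂) = 0 := by linear_combination e1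
    exact (mul_eq_zero.mp this).resolve_left ha
  have hind := L.indep
  rw [LinearIndependent.pair_iff] at hind
  have := hind (k₂ : ℝ) (-(k₁ : ℝ)) (by
    simp only [Complex.real_smul, Complex.ofReal_intCast, Complex.ofReal_neg]
    linear_combination hrel)
  have : (k₁ : ℝ) = 0 := by linarith [this.2]
  exact hk₁0 (by exact_mod_cast this)

/-- The linear embedding of the `z'`-block. [folklore] -/
def zEmb : (γ → ℂ) →ₗ[ℂ] (β ⊕ (γ ⊕ δ) → ℂ) where
  toFun ζ := coords 0 ζ 0
  map_add' ζ ζ' := by simpa using coords_add (β := β) (δ := δ) 0 0 ζ ζ' 0 0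
  map_smul' c ζ := by simpa using coords_smul (β := β) (δ := δ) c 0 ζ 0

omit [Fintype β] [Fintype γ] [Fintype δ] [DecidableEq γ] hΘ in
/-- Unfolding `zEmb`. [folklore] -/
@[simp] theorem zEmb_apply (ζ : γ → ℂ) : zEmb (β := β) (δ := δ) ζ = coords 0 ζ 0 := rfl

/-- `κ` as a linear map. [folklore] -/
def kappaVecₗ : (γ → ℂ) →ₗ[ℂ] (δ → ℂ) where
  toFun := kappaVec κM
  map_add' ζ ζ' := by funext e'; simp [kappaVec, mul_add, Finset.sum_add_distrib]
  map_smul' c ζ := by funext e'; simp [kappaVec, Finset.mul_sum, mul_left_comm]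

omit [Fintype β] [Fintype δ] [DecidableEq γ] hΘ in
/-- Unfolding `kappaVecₗ`. [folklore] -/
@[simp] theorem kappaVecₗ_apply (ζ : γ → ℂ) : kappaVecₗ κM ζ = kappaVec κM ζ := rfl

/-- **One integer vector of `𝔷₀`.** For `σ ∈ 𝒯(H)` with integer `E`-coordinates `v`:
`(0,0,κv) ∈ 𝒯(H)` and `(0,0,s(σ)) ∈ 𝒯(H)` (two lattice moves at `ω₁σ`, `ω₂σ` and the Legendre
relation). [folklore] -/
theorem kappaVec_mem_of_int_lift {H : AddSubgroup (β ⊕ (γ ⊕ δ) → ℂ)}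
    (hH : M.IsClosedG (H : Set (β ⊕ (γ ⊕ δ) → ℂ))) {σ : β ⊕ (γ ⊕ δ) → ℂ}
    (hσ : σ ∈ AnalyticGroupModel.linSpace (H : Set (β ⊕ (γ ⊕ δ) → ℂ))) (v : γ → ℤ) (hσz : ∀ b, σ (iz b) = (v b : ℂ)) :
    coords (0 : β → ℂ) (0 : γ → ℂ) (kappaVec κM (intVec v)) ∈ AnalyticGroupModel.linSpace (H : Set (β ⊕ (γ ⊕ δ) → ℂ)) ∧
      coords (0 : β → ℂ) (0 : γ → ℂ) (sPart σ) ∈ AnalyticGroupModel.linSpace (H : Set (β ⊕ (γ ⊕ δ) → ℂ)) := by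
  set 𝔥 := AnalyticGroupModel.linSpace (H : Set (β ⊕ (γ ⊕ δ) → ℂ)) with h𝔥
  set D : ℂ := L.ω₁ * L.η₂ - L.ω₂ * L.η₁ with hD
  have hD0 : D ≠ 0 := ω₁_mul_η₂_sub_ne_zero L
  set c₁ : δ → ℂ := fun e' => ((L.ω₁ : ℂ) • σ) (is e') - ∑ b, (κM e' b : ℂ) * ((v b : ℂ) * L.η₁ + ((0 : γ → ℤ) b : ℂ) * L.η₂) with hc₁
  set c₂ : δ → ℂ := fun e' => ((L.ω₂ : ℂ) • σ) (is e') - ∑ b, (κM e' b : ℂ) * (((0 : γ → ℤ) b : ℂ) * L.η₁ + (v b : ℂ) * L.η₂) with hc₂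
  have h1 : coords (0 : β → ℂ) (0 : γ → ℂ) c₁ ∈ 𝔥 :=
    sEmb_sub_mem_linSpace L κM M e hΘ hH (Submodule.smul_mem _ (L.ω₁ : ℂ) hσ) v 0 fun b => by simp [hσz b]; ring
  have h2 : coords (0 : β → ℂ) (0 : γ → ℂ) c₂ ∈ 𝔥 :=
    sEmb_sub_mem_linSpace L κM M e hΘ hH (Submodule.smul_mem _ (L.ω₂ : ℂ) hσ) 0 v fun b => by simp [hσz b]; ring
  have hc₁e : ∀ e', c₁ e' = L.ω₁ * σ (is e') - L.η₁ * kappaVec κM (intVec v) e' := by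
    intro e'
    simp only [hc₁, Pi.smul_apply, smul_eq_mul, kappaVec, intVec, Pi.zero_apply, Int.cast_zero, zero_mul, add_zero,
      Finset.mul_sum]
    congr 1
    exact Finset.sum_congr rfl fun b _ => by ring
  have hc₂e : ∀ e', c₂ e' = L.ω₂ * σ (is e') - L.η₂ * kappaVec κM (intVec v) e' := by
    intro e'
    simp only [hc₂, Pi.smul_apply, smul_eq_mul, kappaVec, intVec, Pi.zero_apply, Int.cast_zero, zero_mul, zero_add,
      Finset.mul_sum]
    congr 1
    exact Finset.sum_congr rfl fun b _ => by ring
  have hκ : coords (0 : β → ℂ) (0 : γ → ℂ) (kappaVec κM (intVec v)) =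
      D⁻¹ • ((L.ω₂ : ℂ) • coords (0 : β → ℂ) (0 : γ → ℂ) c₁ - (L.ω₁ : ℂ) • coords (0 : β → ℂ) (0 : γ → ℂ) c₂) := by
    rw [← coords_smul, ← coords_smul, ← coords_sub, ← coords_smul, smul_zero, smul_zero, smul_zero, smul_zero,
      sub_zero, sub_zero, smul_zero, smul_zero]
    congr 1
    funext e'
    simp only [Pi.smul_apply, Pi.sub_apply, smul_eq_mul, hc₁e, hc₂e]
    field_simp
    ring
  have hs : coords (0 : β → ℂ) (0 : γ → ℂ) (sPart σ) =
      D⁻¹ • ((L.η₂ : ℂ) • coords (0 : β → ℂ) (0 : γ → ℂ) c₁ - (L.η₁ : ℂ) • coords (0 : β → ℂ) (0 : γ → ℂ) c₂) := by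
    rw [← coords_smul, ← coords_smul, ← coords_sub, ← coords_smul, smul_zero, smul_zero, smul_zero, smul_zero,
      sub_zero, sub_zero, smul_zero, smul_zero]
    congr 1
    funext e'
    simp only [Pi.smul_apply, Pi.sub_apply, smul_eq_mul, hc₁e, hc₂e, sPart]
    field_simp
    ring
  refine ⟨?_, ?_⟩
  · rw [hκ]; exact Submodule.smul_mem _ _ (Submodule.sub_mem _ (Submodule.smul_mem _ _ h1) (Submodule.smul_mem _ _ h2))
  · rw [hs]; exact Submodule.smul_mem _ _ (Submodule.sub_mem _ (Submodule.smul_mem _ _ h1) (Submodule.smul_mem _ _ h2))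

/-- **The torus datum of an integer vector of `𝔷₀` translates `H` into itself**:
`(ω_i y(σ'), 0, 0) ∈ H` for the lift `σ' = (y, v, 0) ∈ 𝒯(H)` of `v` (it is `ω_i σ'` minus the kernel
vector over `ω_i v` plus `(0, 0, η_i κ v) ∈ 𝒯(H)`). [folklore] -/
theorem coords_omega_smul_yPart_mem {H : AddSubgroup (β ⊕ (γ ⊕ δ) → ℂ)}
    (hH : M.IsClosedG (H : Set (β ⊕ (γ ⊕ δ) → ℂ))) {σ : β ⊕ (γ ⊕ δ) → ℂ}
    (hσ : σ ∈ AnalyticGroupModel.linSpace (H : Set (β ⊕ (γ ⊕ δ) → ℂ))) (v : γ → ℤ) (hσz : ∀ b, σ (iz b) = (v b : ℂ))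
    (hσs : ∀ e', σ (is e') = 0) :
    coords ((L.ω₁ : ℂ) • yPart σ) (0 : γ → ℂ) (0 : δ → ℂ) ∈ H ∧ coords ((L.ω₂ : ℂ) • yPart σ) (0 : γ → ℂ) (0 : δ → ℂ) ∈ H := by
  have hκ := (kappaVec_mem_of_int_lift L κM M e hΘ hH hσ v hσz).1
  have hker : ∀ m n : γ → ℤ, coords (0 : β → ℂ) (fun b => (m b : ℂ) * L.ω₁ + (n b : ℂ) * L.ω₂)
      (fun e' => ∑ b, (κM e' b : ℂ) * ((m b : ℂ) * L.η₁ + (n b : ℂ) * L.η₂)) ∈ H :=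
    fun m n => ker_subset_of_isClosedG L κM M e hΘ hH (coords_lattice_mem_ker L κM m n)
  have h𝔥H : ∀ x ∈ AnalyticGroupModel.linSpace (H : Set (β ⊕ (γ ⊕ δ) → ℂ)), x ∈ H := fun x hx => by
    have := AnalyticGroupModel.linSpace_subset H hx
    exact this
  constructor
  · have hdec : coords ((L.ω₁ : ℂ) • yPart σ) (0 : γ → ℂ) (0 : δ → ℂ) =
        (L.ω₁ : ℂ) • σ - coords (0 : β → ℂ) (fun b => (v b : ℂ) * L.ω₁ + ((0 : γ → ℤ) b : ℂ) * L.ω₂)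
          (fun e' => ∑ b, (κM e' b : ℂ) * ((v b : ℂ) * L.η₁ + ((0 : γ → ℤ) b : ℂ) * L.η₂)) +
        (L.η₁ : ℂ) • coords (0 : β → ℂ) (0 : γ → ℂ) (kappaVec κM (intVec v)) := by
      funext k; rcases k with j | b | e'
      · show coords ((L.ω₁ : ℂ) • yPart σ) (0 : γ → ℂ) (0 : δ → ℂ) (iy j) = ((L.ω₁ : ℂ) • σ - coords (0 : β → ℂ) (fun b => (v b : ℂ) * L.ω₁ + ((0 : γ → ℤ) b : ℂ) * L.ω₂) (fun e' => ∑ b, (κM e' b : ℂ) * ((v b : ℂ) * L.η₁ + ((0 : γ → ℤ) b : ℂ) * L.η₂)) + (L.η₁ : ℂ) • coords (0 : β → ℂ) (0 : γ → ℂ) (kappaVec κM (intVec v))) (iy j)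
        simp [yPart]
      · show coords ((L.ω₁ : ℂ) • yPart σ) (0 : γ → ℂ) (0 : δ → ℂ) (iz b) = ((L.ω₁ : ℂ) • σ - coords (0 : β → ℂ) (fun b => (v b : ℂ) * L.ω₁ + ((0 : γ → ℤ) b : ℂ) * L.ω₂) (fun e' => ∑ b, (κM e' b : ℂ) * ((v b : ℂ) * L.η₁ + ((0 : γ → ℤ) b : ℂ) * L.η₂)) + (L.η₁ : ℂ) • coords (0 : β → ℂ) (0 : γ → ℂ) (kappaVec κM (intVec v))) (iz b)
        simp [hσz b]; ring
      · show coords ((L.ω₁ : ℂ) • yPart σ) (0 : γ → ℂ) (0 : δ → ℂ) (is e') = ((L.ω₁ : ℂ) • σ - coords (0 : β → ℂ) (fun b => (v b : ℂ) * L.ω₁ + ((0 : γ → ℤ) b : ℂ) * L.ω₂) (fun e' => ∑ b, (κM e' b : ℂ) * ((v b : ℂ) * L.η₁ + ((0 : γ → ℤ) b : ℂ) * L.η₂)) + (L.η₁ : ℂ) • coords (0 : β → ℂ) (0 : γ → ℂ) (kappaVec κM (intVec v))) (is e')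
        simp [hσs e', kappaVec, intVec, Finset.mul_sum]
        rw [← Finset.sum_neg_distrib, ← Finset.sum_add_distrib]
        exact (Finset.sum_eq_zero fun b _ => by ring).symm
    rw [hdec]
    exact H.add_mem (H.sub_mem (h𝔥H _ (Submodule.smul_mem _ _ hσ)) (hker v 0)) (h𝔥H _ (Submodule.smul_mem _ _ hκ))
  · have hdec : coords ((L.ω₂ : ℂ) • yPart σ) (0 : γ → ℂ) (0 : δ → ℂ) =
        (L.ω₂ : ℂ) • σ - coords (0 : β → ℂ) (fun b => ((0 : γ → ℤ) b : ℂ) * L.ω₁ + (v b : ℂ) * L.ω₂)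
          (fun e' => ∑ b, (κM e' b : ℂ) * (((0 : γ → ℤ) b : ℂ) * L.η₁ + (v b : ℂ) * L.η₂)) +
        (L.η₂ : ℂ) • coords (0 : β → ℂ) (0 : γ → ℂ) (kappaVec κM (intVec v)) := by
      funext k; rcases k with j | b | e'
      · show coords ((L.ω₂ : ℂ) • yPart σ) (0 : γ → ℂ) (0 : δ → ℂ) (iy j) = ((L.ω₂ : ℂ) • σ - coords (0 : β → ℂ) (fun b => ((0 : γ → ℤ) b : ℂ) * L.ω₁ + (v b : ℂ) * L.ω₂) (fun e' => ∑ b, (κM e' b : ℂ) * (((0 : γ → ℤ) b : ℂ) * L.η₁ + (v b : ℂ) * L.η₂)) + (L.η₂ : ℂ) • coords (0 : β → ℂ) (0 : γ → ℂ) (kappaVec κM (intVec v))) (iy j)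
        simp [yPart]
      · show coords ((L.ω₂ : ℂ) • yPart σ) (0 : γ → ℂ) (0 : δ → ℂ) (iz b) = ((L.ω₂ : ℂ) • σ - coords (0 : β → ℂ) (fun b => ((0 : γ → ℤ) b : ℂ) * L.ω₁ + (v b : ℂ) * L.ω₂) (fun e' => ∑ b, (κM e' b : ℂ) * (((0 : γ → ℤ) b : ℂ) * L.η₁ + (v b : ℂ) * L.η₂)) + (L.η₂ : ℂ) • coords (0 : β → ℂ) (0 : γ → ℂ) (kappaVec κM (intVec v))) (iz b)
        simp [hσz b]; ring
      · show coords ((L.ω₂ : ℂ) • yPart σ) (0 : γ → ℂ) (0 : δ → ℂ) (is e') = ((L.ω₂ : ℂ) • σ - coords (0 : β → ℂ) (fun b => ((0 : γ → ℤ) b : ℂ) * L.ω₁ + (v b : ℂ) * L.ω₂) (fun e' => ∑ b, (κM e' b : ℂ) * (((0 : γ → ℤ) b : ℂ) * L.η₁ + (v b : ℂ) * L.η₂)) + (L.η₂ : ℂ) • coords (0 : β → ℂ) (0 : γ → ℂ) (kappaVec κM (intVec v))) (is e')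
        simp [hσs e', kappaVec, intVec, Finset.mul_sum]
        rw [← Finset.sum_neg_distrib, ← Finset.sum_add_distrib]
        exact (Finset.sum_eq_zero fun b _ => by ring).symm
    rw [hdec]
    exact H.add_mem (H.sub_mem (h𝔥H _ (Submodule.smul_mem _ _ hσ)) (hker 0 v)) (h𝔥H _ (Submodule.smul_mem _ _ hκ))

/-- **Compatibility and splitting.** Assume the `E`-projection `𝔷₀ = z'(𝒯(H))` is spanned by
integer vectors lying in it (`hT`, `hspan`). Then for every `ζ ∈ 𝔷₀`: `(0, 0, κζ) ∈ 𝒯(H)`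
(compatibility of the vector part with the abelian part) and `(0, ζ, 0) ∈ 𝒯(H)` (splitting).
Proof for an integer `v`: lift, remove the vector part (`kappaVec_mem_of_int_lift`), and move the
torus part `y` into `yDir` by the Artin move on the subgroup generated by the `ω_i y`
(`coords_omega_smul_yPart_mem`; a character of `ℤ^β` trivial on `ω₁y, ω₂y` kills `y` since
`ω₂/ω₁ ∉ ℝ`). [folklore] -/
theorem kappaVec_mem_and_zEmb_mem {H : AddSubgroup (β ⊕ (γ ⊕ δ) → ℂ)}
    (hH : M.IsClosedG (H : Set (β ⊕ (γ ⊕ δ) → ℂ))) (T : Set (γ → ℤ))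
    (hT : ∀ v ∈ T, intVec v ∈ (AnalyticGroupModel.linSpace (H : Set (β ⊕ (γ ⊕ δ) → ℂ))).map zProj)
    (hspan : (AnalyticGroupModel.linSpace (H : Set (β ⊕ (γ ⊕ δ) → ℂ))).map zProj ≤ Submodule.span ℂ (intVec '' T))
    {ζ : γ → ℂ} (hζ : ζ ∈ (AnalyticGroupModel.linSpace (H : Set (β ⊕ (γ ⊕ δ) → ℂ))).map zProj) :
    coords (0 : β → ℂ) (0 : γ → ℂ) (kappaVec κM ζ) ∈ AnalyticGroupModel.linSpace (H : Set (β ⊕ (γ ⊕ δ) → ℂ)) ∧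
      coords (0 : β → ℂ) ζ (0 : δ → ℂ) ∈ AnalyticGroupModel.linSpace (H : Set (β ⊕ (γ ⊕ δ) → ℂ)) := by
  classical
  set 𝔥 := AnalyticGroupModel.linSpace (H : Set (β ⊕ (γ ⊕ δ) → ℂ)) with h𝔥
  -- lifts of the integer vectors with vanishing vector part
  have hlift : ∀ v ∈ T, ∃ σ ∈ 𝔥, (∀ b, σ (iz b) = (v b : ℂ)) ∧ ∀ e', σ (is e') = 0 := by
    intro v hv
    obtain ⟨σ, hσ, hσz⟩ := Submodule.mem_map.mp (hT v hv)
    have hσb : ∀ b, σ (iz b) = (v b : ℂ) := fun b => by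
      have := congrFun hσz b; simpa [intVec] using this
    have hs := (kappaVec_mem_of_int_lift L κM M e hΘ hH hσ v hσb).2
    refine ⟨σ - coords (0 : β → ℂ) (0 : γ → ℂ) (sPart σ), Submodule.sub_mem _ hσ hs, fun b => by simp [hσb b],
      fun e' => by simp [sPart]⟩
  -- the subgroup of the torus data `ω_i y(σ_v)`
  set Γ : AddSubgroup (β → ℂ) := AddSubgroup.closure
    {g | ∃ σ ∈ 𝔥, (∃ v ∈ T, ∀ b, σ (iz b) = (v b : ℂ)) ∧ (∀ e', σ (is e') = 0) ∧
      (g = (L.ω₁ : ℂ) • yPart σ ∨ g = (L.ω₂ : ℂ) • yPart σ)} with hΓ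
  have hΓH : ∀ g ∈ Γ, coords g (0 : γ → ℂ) (0 : δ → ℂ) ∈ H := by
    intro g hg
    have : Γ ≤ H.comap (yEmb (γ := γ) (δ := δ)).toAddMonoidHom := by
      rw [hΓ, AddSubgroup.closure_le]
      rintro g ⟨σ, hσ, ⟨v, -, hσz⟩, hσs, hg⟩
      obtain ⟨h1, h2⟩ := coords_omega_smul_yPart_mem L κM M e hΘ hH hσ v hσz hσs
      rcases hg with rfl | rfl
      · exact h1
      · exact h2
    exact this hg
  -- Artin: `charPerp Γ ⊆ yDir 𝔥`
  have hArtin : ∀ θ ∈ charPerp (β := β) Γ, coords θ (0 : γ → ℂ) (0 : δ → ℂ) ∈ 𝔥 := by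
    intro θ hθ
    refine mem_linSpace_of_forall_thetaEval L κM M e hΘ hH fun D P _ hvan w hw t => ?_
    have h := thetaEval_eq_zero_of_forall_mem_addSubgroup L κM P (w := w) Γ
      (fun g hg => hvan _ (H.add_mem hw (hΓH g hg))) (Submodule.smul_mem _ t hθ)
    have hv : t • coords θ (0 : γ → ℂ) (0 : δ → ℂ) = coords (t • θ) (0 : γ → ℂ) (0 : δ → ℂ) := by
      rw [← coords_smul, smul_zero, smul_zero]
    rw [hv]
    exact h
  -- the torus datum of each lift lies in `charPerp Γ`
  have hsplit : ∀ v ∈ T, coords (0 : β → ℂ) (intVec v) (0 : δ → ℂ) ∈ 𝔥 := by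
    intro v hv
    obtain ⟨σ, hσ, hσz, hσs⟩ := hlift v hv
    have hy : yPart σ ∈ charPerp (β := β) Γ := by
      rw [mem_charPerp_iff]
      intro q hq
      have hgen : ∀ ω : ℂ, (ω = L.ω₁ ∨ ω = L.ω₂) → ∃ k : ℤ, (∑ j, (q j : ℂ) * yPart σ j) * ω = k * (2 * Real.pi * I) := by
        intro ω hω
        have hmem : ω • yPart σ ∈ Γ := by
          refine AddSubgroup.subset_closure ⟨σ, hσ, ⟨v, hv, hσz⟩, hσs, ?_⟩
          rcases hω with rfl | rfl
          · exact Or.inl rfl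
          · exact Or.inr rfl
        obtain ⟨k, hk⟩ := Complex.exp_eq_one_iff.mp (hq _ hmem)
        refine ⟨k, ?_⟩
        rw [← hk, Finset.sum_mul]
        exact Finset.sum_congr rfl fun j _ => by simp; ring
      exact eq_zero_of_mul_omega_mem_two_pi_I L (hgen _ (Or.inl rfl)) (hgen _ (Or.inr rfl))
    have hyθ := hArtin _ hy
    have hdec : coords (0 : β → ℂ) (intVec v) (0 : δ → ℂ) = σ - coords (yPart σ) (0 : γ → ℂ) (0 : δ → ℂ) := by
      funext k; rcases k with j | b | e'
      · change coords (0 : β → ℂ) (intVec v) (0 : δ → ℂ) (iy j) = (σ - coords (yPart σ) (0 : γ → ℂ) (0 : δ → ℂ)) (iy j)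
        simp [yPart]
      · change coords (0 : β → ℂ) (intVec v) (0 : δ → ℂ) (iz b) = (σ - coords (yPart σ) (0 : γ → ℂ) (0 : δ → ℂ)) (iz b)
        simp [intVec, hσz b]
      · change coords (0 : β → ℂ) (intVec v) (0 : δ → ℂ) (is e') = (σ - coords (yPart σ) (0 : γ → ℂ) (0 : δ → ℂ)) (is e')
        simp [hσs e']
    rw [hdec]
    exact Submodule.sub_mem _ hσ hyθ
  have hκint : ∀ v ∈ T, coords (0 : β → ℂ) (0 : γ → ℂ) (kappaVec κM (intVec v)) ∈ 𝔥 := by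
    intro v hv
    obtain ⟨σ, hσ, hσz, -⟩ := hlift v hv
    exact (kappaVec_mem_of_int_lift L κM M e hΘ hH hσ v hσz).1
  -- pass to the span
  have hζspan : ζ ∈ Submodule.span ℂ (intVec '' T) := hspan hζ
  constructor
  · have hle : Submodule.span ℂ (intVec '' T) ≤ 𝔥.comap ((sEmb (β := β) (γ := γ)).comp (kappaVecₗ κM)) := by
      refine Submodule.span_le.mpr ?_
      rintro _ ⟨v, hv, rfl⟩
      exact hκint v hv
    exact hle hζspan
  · have hle : Submodule.span ℂ (intVec '' T) ≤ 𝔥.comap (zEmb (β := β) (δ := δ)) := by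
      refine Submodule.span_le.mpr ?_
      rintro _ ⟨v, hv, rfl⟩
      exact hsplit v hv
    exact hle hζspan

end Model

end Std

end GaGmE

end Literature.NumberTheory.Transcendental

end
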